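import Literature.NumberTheory.Transcendental.TaylorCoeffPadic
import Literature.NumberTheory.Transcendental.TaylorCoeffIntegral
import HarnessLib

/-!
# `p`-adic orders of DIVIDED derivatives (Taylor coefficients) of rational functions over `ℚ`

Topic `Literature/NumberTheory/Transcendental`. Companion of `TaylorCoeffPadic.lean`. That file's
`IsDOrd p e N f x` bounds the orders of the ITERATED derivatives `f^{(j)}(x)` by `e - j`; for the
divided derivatives `(1/j!) f^{(j)}(x)` it therefore loses `ord_p j!` and is usable only for `p > N`
(`IsDOrd.padicOrdGe_divDeriv`). The brick lemmas of [Zudilin2004, §7] (Lemmas 17, 18: "for all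
non-negative integers `j`") and their use in [RivoalZudilin2020, §3] (where the primes `p > 2√n` of
the saving `Φ_n` may be much smaller than the order `A - 1` of the derivatives) are statements about
the DIVIDED derivatives with NO loss: if each factor of a product has `ord_p (1/j!) F^{(j)}(x) ≥ e_F - j`
for all `j`, so does the product with `e = Σ e_F`, because the Leibniz rule for divided derivatives has
no binomial coefficients (`Literature.Analysis.Calculus.divDeriv_mul`).

* `IsDOrdDiv p e N f x` — `f` is `C^N` at `x` and `ord_p (1/j!) f^{(j)}(x) ≥ e - j` for `j ≤ N`;
  closed under products (exponents add), powers, sums (same exponent), constants, local;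
* the elementary factors at a point `x`: an affine factor `a t + c` with `ord_p (a x + c) ≥ e ≤ 1` and
  `ord_p a ≥ 0` (`isDOrdDiv_affine`, `isDOrdDiv_add_const`), and an inverse factor `(t + c)⁻¹` with
  `x + c ≠ 0`, `ord_p (x + c) ≤ 1` (`isDOrdDiv_inv_add_const`: exponent `-[p ∣ x + c]`);
* `IsDOrdDiv.padicOrdGe` — the bound at a single `j`.

Everything here is PROVED (no named facts).

## References

* [Zudilin2004] W. Zudilin, *Arithmetic of linear forms involving odd zeta values*, J. Théor.
  Nombres Bordeaux 16 (2004), 251–291, §7 (Lemmas 17–18: bounds for `R^{(j)}(-k)/j!`).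
* [RivoalZudilin2020] T. Rivoal, W. Zudilin, *A note on odd zeta values*, Sém. Lothar. Combin. 81
  (2020), B81b, §3 (proof of Proposition 1 (ii)).
-/

noncomputable section

open Finset Filter Literature.Analysis.Calculus
open scoped Nat

namespace Literature.NumberTheory.Transcendental

/-! ### `ord_p 𝒟ⱼ f(x) ≥ e - j` for `j ≤ N` -/

/-- `IsDOrdDiv p e N f x`: `f` is `C^N` at `x` and the divided derivatives satisfy
`ord_p (1/j!) f^{(j)}(x) ≥ e - j` for every `j ≤ N` (the shape of [Zudilin2004, Lemmas 17–18],
which are stated for the divided derivatives). [cite: Zudilin2004, §7 Lemmas 17–18] -/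
structure IsDOrdDiv (p : ℕ) (e : ℤ) (N : ℕ) (f : ℚ → ℚ) (x : ℚ) : Prop where
  contDiffAt : ContDiffAt ℚ N f x
  ord : ∀ j ≤ N, PadicOrdGe p (e - j) (divDeriv j f x)

namespace IsDOrdDiv

variable {p : ℕ} {e e' : ℤ} {N : ℕ} {f g : ℚ → ℚ} {x : ℚ}

/-- The bound at one order `j ≤ N`. [cite: Zudilin2004, §7 Lemmas 17–18 (proof: Leibniz rule for R^{(j)}/j!)] -/
theorem padicOrdGe (h : IsDOrdDiv p e N f x) {j : ℕ} (hj : j ≤ N) :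
    PadicOrdGe p (e - j) (divDeriv j f x) :=
  h.ord j hj

/-- Lower the order. [cite: Zudilin2004, §7 Lemmas 17–18 (proof: Leibniz rule for R^{(j)}/j!)] -/
theorem of_le (h : IsDOrdDiv p e N f x) {M : ℕ} (hM : M ≤ N) : IsDOrdDiv p e M f x :=
  ⟨h.contDiffAt.of_le (by exact_mod_cast hM), fun j hj => h.ord j (hj.trans hM)⟩

/-- Weaken the exponent. [cite: Zudilin2004, §7 Lemmas 17–18 (proof: Leibniz rule for R^{(j)}/j!)] -/
theorem mono (h : IsDOrdDiv p e N f x) (he : e' ≤ e) : IsDOrdDiv p e' N f x :=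
  ⟨h.contDiffAt, fun j hj => (h.ord j hj).mono (by omega)⟩

/-- **Closure under products** (Leibniz rule for divided derivatives, no binomial coefficients):
the exponents add, with no condition on `p` versus `N`. [cite: Zudilin2004, §7 Lemmas 17–18 (proof: Leibniz rule for R^{(j)}/j!)] -/
theorem mul [Fact p.Prime] (hf : IsDOrdDiv p e N f x) (hg : IsDOrdDiv p e' N g x) :
    IsDOrdDiv p (e + e') N (fun t => f t * g t) x := by
  refine ⟨hf.contDiffAt.mul hg.contDiffAt, fun j hj => ?_⟩
  have hfj : ContDiffAt ℚ j f x := hf.contDiffAt.of_le (by exact_mod_cast hj)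
  have hgj : ContDiffAt ℚ j g x := hg.contDiffAt.of_le (by exact_mod_cast hj)
  rw [divDeriv_fun_mul hfj hgj]
  refine PadicOrdGe.sum fun i hi => ?_
  have hij : i ≤ j := Nat.lt_succ_iff.1 (mem_range.1 hi)
  have h2 := hf.ord i (hij.trans hj)
  have h3 := hg.ord (j - i) ((Nat.sub_le j i).trans hj)
  refine (h2.mul h3).mono (le_of_eq ?_)
  push_cast [Nat.cast_sub hij]
  ring

/-- A constant `c` with `ord_p c ≥ v`. [cite: Zudilin2004, §7 Lemmas 17–18 (proof: Leibniz rule for R^{(j)}/j!)] -/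
theorem const (N : ℕ) (x : ℚ) {c : ℚ} {v : ℤ} (hc : PadicOrdGe p v c) :
    IsDOrdDiv p v N (fun _ => c) x := by
  refine ⟨contDiffAt_const, fun j _ => ?_⟩
  rw [divDeriv_const]
  split_ifs with hj
  · subst hj; simpa using hc
  · exact PadicOrdGe.zero _

/-- The constant function `1`. [cite: Zudilin2004, §7 Lemmas 17–18 (proof: Leibniz rule for R^{(j)}/j!)] -/
theorem one (N : ℕ) (x : ℚ) : IsDOrdDiv p 0 N (fun _ => (1 : ℚ)) x :=
  const N x (by simpa using PadicOrdGe.of_int (p := p) 1)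

/-- Finite products: the exponents add up. [cite: Zudilin2004, §7 Lemmas 17–18 (proof: Leibniz rule for R^{(j)}/j!)] -/
theorem prod [Fact p.Prime] {ι : Type*} (s : Finset ι) {E : ι → ℤ} {F : ι → ℚ → ℚ}
    (h : ∀ i ∈ s, IsDOrdDiv p (E i) N (F i) x) :
    IsDOrdDiv p (∑ i ∈ s, E i) N (fun t => ∏ i ∈ s, F i t) x := by
  classical
  induction s using Finset.induction_on with
  | empty => simpa using one (p := p) N x
  | insert a s ha ih =>
    have := (h a (mem_insert_self a s)).mul (ih fun i hi => h i (mem_insert_of_mem hi))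
    simpa [prod_insert ha, sum_insert ha] using this

/-- Powers. [cite: Zudilin2004, §7 Lemmas 17–18 (proof: Leibniz rule for R^{(j)}/j!)] -/
theorem pow [Fact p.Prime] (h : IsDOrdDiv p e N f x) (n : ℕ) :
    IsDOrdDiv p (n * e) N (fun t => f t ^ n) x := by
  induction n with
  | zero => simpa using one (p := p) N x
  | succ n ih =>
    have := ih.mul h
    simp only [pow_succ]
    convert this using 2
    push_cast
    ring

/-- Multiplication by a constant `c` with `ord_p c ≥ v` shifts the exponent by `v`. [cite: Zudilin2004, §7 Lemmas 17–18 (proof: Leibniz rule for R^{(j)}/j!)] -/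
theorem const_mul [Fact p.Prime] (hf : IsDOrdDiv p e N f x) {c : ℚ} {v : ℤ}
    (hc : PadicOrdGe p v c) : IsDOrdDiv p (v + e) N (fun t => c * f t) x :=
  (const N x hc).mul hf

/-- Closure under sums (same exponent). [cite: Zudilin2004, §7 Lemmas 17–18 (proof: Leibniz rule for R^{(j)}/j!)] -/
theorem add [Fact p.Prime] (hf : IsDOrdDiv p e N f x) (hg : IsDOrdDiv p e N g x) :
    IsDOrdDiv p e N (fun t => f t + g t) x := by
  refine ⟨hf.contDiffAt.add hg.contDiffAt, fun j hj => ?_⟩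
  have hfj : ContDiffAt ℚ j f x := hf.contDiffAt.of_le (by exact_mod_cast hj)
  have hgj : ContDiffAt ℚ j g x := hg.contDiffAt.of_le (by exact_mod_cast hj)
  rw [divDeriv_fun_add hfj hgj]
  exact (hf.ord j hj).add (hg.ord j hj)

/-- `IsDOrdDiv` only depends on the germ of `f` at `x`. [cite: Zudilin2004, §7 Lemmas 17–18 (proof: Leibniz rule for R^{(j)}/j!)] -/
theorem congr (hf : IsDOrdDiv p e N f x) (hfg : f =ᶠ[nhds x] g) : IsDOrdDiv p e N g x := by
  refine ⟨hf.contDiffAt.congr_of_eventuallyEq hfg.symm, fun j hj => ?_⟩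
  rw [← divDeriv_congr hfg]
  exact hf.ord j hj

/-- From `IsDOrdDiv` to the iterated-derivative form `IsDOrd` (multiply by `j!`, which has
non-negative order): the divided form is the stronger one. [cite: Zudilin2004, §7 Lemmas 17–18 (proof: Leibniz rule for R^{(j)}/j!)] -/
theorem isDOrd [Fact p.Prime] (h : IsDOrdDiv p e N f x) : IsDOrd p e N f x := by
  refine ⟨h.contDiffAt, fun j hj => ?_⟩
  rw [iteratedDeriv_eq_factorial_mul_divDeriv]
  simpa using (PadicOrdGe.of_nat (p := p) (j !)).mul (h.ord j hj)

end IsDOrdDiv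

/-! ### Affine and inverse-affine factors -/

/-- Divided derivatives of an affine function `a t + c`: the value, then `a`, then `0`. [cite: Zudilin2004, §7 Lemma 17 (proof)] -/
theorem divDeriv_affine (a c x : ℚ) (j : ℕ) :
    divDeriv j (fun t : ℚ => a * t + c) x = if j = 0 then a * x + c else if j = 1 then a else 0 := by
  rw [divDeriv, iteratedDeriv_affine]
  rcases j with _ | _ | j
  · simp
  · simp
  · simp

/-- An affine factor `a t + c` at a point `x` where `ord_p (a x + c) ≥ e`, with `e ≤ 1` and
`ord_p a ≥ 0`, satisfies `IsDOrdDiv p e N` (orders `e, ≥ 0 ≥ e - 1, ∞` of `a x + c, a, 0`).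
[cite: Zudilin2004, §7 Lemma 17 (proof)] -/
theorem isDOrdDiv_affine (p : ℕ) {a c x : ℚ} {e : ℤ} (he : e ≤ 1) (h0 : PadicOrdGe p e (a * x + c))
    (h1 : PadicOrdGe p 0 a) (N : ℕ) : IsDOrdDiv p e N (fun t : ℚ => a * t + c) x := by
  refine ⟨(contDiffAt_const.mul contDiffAt_id).add contDiffAt_const, fun j _ => ?_⟩
  rw [divDeriv_affine]
  rcases j with _ | _ | j
  · simpa using h0
  · simpa using h1.mono (by omega)
  · simp only [Nat.succ_ne_zero, if_false, Nat.add_eq_right]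
    exact PadicOrdGe.zero _

/-- The order of a non-zero integer `z` with `ord_p z ≤ 1` is at least `[p ∣ z]`, and this
indicator is at most `1`. [cite: Zudilin2004, §7 Lemma 17 (proof)] -/
theorem padicOrdGe_indicator_intCast (p : ℕ) [hp : Fact p.Prime] (z : ℤ) :
    PadicOrdGe p (if (p : ℤ) ∣ z then 1 else 0) (z : ℚ) := by
  by_cases hz : z = 0
  · subst hz; simpa using PadicOrdGe.zero (p := p) _
  split_ifs with hdvd
  · refine Or.inr ?_
    have h1 : (1 : ℕ) ≤ padicValInt p z :=
      ((padicValInt_dvd_iff 1 z).1 (by simpa using hdvd)).resolve_left hz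
    rw [padicValRat.of_int]
    exact_mod_cast h1
  · exact PadicOrdGe.of_int _

/-- At a point `x` with `x + c = z ∈ ℤ`: the linear factor `t + c` satisfies `IsDOrdDiv p [p ∣ z] N`.
(At `t = -k` with `c ∈ ℤ` this is [Zudilin2004, Lemma 17]'s count for one factor; here `c` may be a
half-integer as in [RivoalZudilin2020, §3], as long as the VALUE is an integer — e.g. after doubling.)
[cite: Zudilin2004, §7 Lemma 17 (proof)] -/
theorem isDOrdDiv_add_const (p : ℕ) [hp : Fact p.Prime] {c x : ℚ} (z : ℤ) (hz : x + c = z) (N : ℕ) :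
    IsDOrdDiv p (if (p : ℤ) ∣ z then 1 else 0) N (fun t : ℚ => t + c) x := by
  have h := isDOrdDiv_affine p (a := 1) (c := c) (x := x) (e := if (p : ℤ) ∣ z then 1 else 0)
    (by split_ifs <;> omega) (by rw [one_mul, hz]; exact padicOrdGe_indicator_intCast p z)
    (by simpa using PadicOrdGe.of_int (p := p) 1) N
  exact h.congr (Eventually.of_forall fun t => by simp)

/-- A doubled linear factor `2t + c'` at a point `x` with `2x + c' = z ∈ ℤ` (for `p` odd or not:
`ord_p 2 ≥ 0` always): `IsDOrdDiv p [p ∣ z] N`. This is the form in which the half-integer shifts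
`t - n + ½ + i` of [RivoalZudilin2020, §2] enter (`2t - 2n + 1 + 2i`). [cite: RivoalZudilin2020, §3 (proof of Proposition 1 (ii))] -/
theorem isDOrdDiv_two_mul_add_const (p : ℕ) [hp : Fact p.Prime] {c x : ℚ} (z : ℤ)
    (hz : 2 * x + c = z) (N : ℕ) :
    IsDOrdDiv p (if (p : ℤ) ∣ z then 1 else 0) N (fun t : ℚ => 2 * t + c) x :=
  isDOrdDiv_affine p (by split_ifs <;> omega) (by rw [hz]; exact padicOrdGe_indicator_intCast p z)
    (by simpa using PadicOrdGe.of_nat (p := p) 2) N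

/-- At a point `x` with `x + c = z`, `z` a NON-ZERO integer with `ord_p z ≤ 1` (e.g. `0 < |z| < p²`):
the inverse factor `(t + c)⁻¹` satisfies `IsDOrdDiv p (-[p ∣ z]) N`, since
`𝒟ⱼ[(t+c)⁻¹](x) = (-1)ʲ z^{-(j+1)}` has order `-(j+1) ord_p z ≥ -[p ∣ z] - j`.
([Zudilin2004, Lemma 18]'s count for one factor.) [cite: Zudilin2004, §7 Lemma 18 (proof)] -/
theorem isDOrdDiv_inv_add_const (p : ℕ) [hp : Fact p.Prime] {c x : ℚ} (z : ℤ) (hz : x + c = z)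
    (hz0 : z ≠ 0) (hv : padicValInt p z ≤ 1) (N : ℕ) :
    IsDOrdDiv p (if (p : ℤ) ∣ z then -1 else 0) N (fun t : ℚ => (t + c)⁻¹) x := by
  have hne : x + c ≠ 0 := by rw [hz]; exact_mod_cast hz0
  refine ⟨contDiffAt_inv_add_const hne, fun j _ => ?_⟩
  rw [divDeriv_inv_add_const j hne, div_eq_mul_inv, hz]
  have h3 : PadicOrdGe p (-((j + 1 : ℕ) * padicValRat p (z : ℚ))) (((z : ℚ) ^ (j + 1))⁻¹) := by
    refine Or.inr (le_of_eq ?_)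
    rw [padicValRat.inv, padicValRat.pow]
  have h2 : PadicOrdGe p 0 ((-1 : ℚ) ^ j) := by
    have := PadicOrdGe.of_int (p := p) ((-1) ^ j)
    simpa using this
  refine (h2.mul h3).mono ?_
  rw [padicValRat.of_int]
  split_ifs with hdvd
  · have h1' : (1 : ℕ) ≤ padicValInt p z :=
      ((padicValInt_dvd_iff 1 z).1 (by simpa using hdvd)).resolve_left hz0
    have : padicValInt p z = 1 := le_antisymm hv h1'
    rw [this]; push_cast; omega
  · have : padicValInt p z = 0 := padicValInt.eq_zero_of_not_dvd hdvd
    rw [this]; push_cast; omega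

/-- `ord_p z ≤ 1` for a non-zero integer with `|z| < p²`. [cite: Zudilin2004, §7 Lemma 18 (hypothesis p² > b₀-a₀-1)] -/
theorem padicValInt_le_one_of_abs_lt_sq (p : ℕ) [hp : Fact p.Prime] {z : ℤ} (hz0 : z ≠ 0)
    (hz : |z| < (p : ℤ) ^ 2) : padicValInt p z ≤ 1 := by
  by_contra hcon
  push Not at hcon
  have h2 : (2 : ℕ) ≤ padicValInt p z := hcon
  have hdvd : (p : ℤ) ^ 2 ∣ z := (padicValInt_dvd_iff 2 _).2 (Or.inr h2)
  exact hz0 (Int.eq_zero_of_abs_lt_dvd hdvd hz)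

/-- Powers of an inverse factor: `((t + c)⁻¹)^s` has exponent `-s [p ∣ z]` (same hypotheses).
[cite: Zudilin2004, §7 Lemma 18 (proof)] -/
theorem isDOrdDiv_inv_add_const_pow (p : ℕ) [hp : Fact p.Prime] {c x : ℚ} (z : ℤ) (hz : x + c = z)
    (hz0 : z ≠ 0) (hv : padicValInt p z ≤ 1) (s N : ℕ) :
    IsDOrdDiv p ((s : ℤ) * (if (p : ℤ) ∣ z then -1 else 0)) N (fun t : ℚ => ((t + c)⁻¹) ^ s) x :=
  (isDOrdDiv_inv_add_const p z hz hz0 hv N).pow s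

end Literature.NumberTheory.Transcendental
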